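import Summits.CriticalPhenomena.PercolationContinuityZ3.Theorems.Transplant.GrigorchukLamplighterCayleyClasses
import Summits.CriticalPhenomena.PercolationContinuityZ3.Theorems.Transplant.GrigorchukSectionsDefs
import Literature.Barriers.CriticalPhenomena.SubexponentialGrowthZd
import HarnessLib

/-!
# On `Γ₂ = ℤ ≀_X 𝔊`: THE KERNEL OF THE BLOCK CHARACTER `ψ : (⊕_X ℤ) ⋊ St(1) → ℤ²` IS GENERATED BY KERNEL ELEMENTS OF WORD LENGTH `≤ 9` in
# `Cay(ℤ ≀_X 𝔊; a, b, c, d, s)` — the kernel-displacement input (`ker_gen`) of the quasi-step orbit datum on Bartholdi–Erschler's graph, WITHOUT any growth statement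

builds on p205010 (kernel theorem, internal audit signed; external expert review pending) — nothing in this file uses p205010; nothing here is a percolation
statement.  Lane `prim-bschramm`, seat `prim-bschramm-p3` gen 36 (design owner; offer O14 / F4, lead GO 2026-08-28 #7877).  Helper file (`--supports
stmt-CriticalPhenomena-4575 --as helper`).  Def-free, over «GrigorchukLamplighterDefs» (p582067's `stabOneW`, `blockChar`), «GrigorchukLamplighterShortCycles» /
«…CayleyClasses» (`stdGens`, the letter codes `L6`, `Cay`), «GrigorchukSectionsDefs» (p590401: `stabOneGens`, `St_𝔊(1) = ⟨b, c, d, aba, aca, ada⟩`).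

WHY.  The quasi-step orbit datum `AutChart.OrbitQDatum` (p497322) asks that `ker ψ` be generated by kernel elements moving the base point a bounded distance; the
lane's general existence theorem («AutChartOrbitsQCylinders» `exists_orbitQDatum`) gets this from the relative Milnor lemma OFF exponential growth — unusable here,
since the (intermediate) growth of `Γ₂` is cited, not typed.  This file proves it for `Γ₂` by ALGEBRA instead:
* §1 balls of `Cay` (products / inverses: «CayleyMilnorWords» `Milnor.mul_mem_graphBall` / `inv_mem_graphBall`): letters, `a t a`, the base point `a` (`mul_aW_mem_graphBall`);
* §2 `ker ψ = L₀ ⋊ St_𝔊(1)`, `L₀` = configurations on `X = 𝔊ρ` with both block sums zero.  `St_𝔊(1)` is generated by the six words `b, c, d, aba, aca, ada`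
  (p590401 `stabOne_inf_grigorchukGroup`) — lamp-free kernel elements of length `≤ 3` (`exists_tree_witness`) — and with them every conjugate `u x u⁻¹`,
  `x ∈ St_𝔊(1)`, `u ∈ {1, s, s′ = asa}`, is a product of the conjugates `u t u⁻¹` of the six words, kernel elements of length `≤ 9` (`exists_conj_of_mem_closure`);
  `L₀` is generated by the differences `δ_{hρ} − δ_ρ = h·(s h s⁻¹)⁻¹` and `δ_{h aρ} − δ_{aρ} = h·(s′ h s′⁻¹)⁻¹`, `h ∈ St_𝔊(1)` (`exists_diff_single`, using
  `[𝔊 : St(1)] = 2`, p590401 `mem_closure_stabOneGens_or`), and every configuration supported in `X` collapses modulo them onto `{ρ, aρ}` (`exists_lamp_normalForm`);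
  the lamp support of every element of `Γ₂` lies in `X` (`exists_apply_rho_of_mem_support`).  Hence **`ker_blockChar_le_closure`**: every `k ∈ ker ψ` lies in the
  subgroup generated by `{g : ψ g = 0, g ∈ B_Cay(1, 9)}`.
[cite: BartholdiErschler2012, §2 (standard generating set; W = Σ_X A ⋊ G, X = ρG), §3.1 (St(1) = ⟨b,c,d,aba,aca,ada⟩ ∩ …, [G : St(1)] = 2, ρ = 1^∞)]
[cite: MilnorSolvableGrowth1968, Lemma 1 (the kernel-generation input it replaces)]
-/

noncomputable section

namespace Summit.CriticalPhenomena.PercolationContinuityZ3.Theorems.Transplant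

namespace Grigorchuk

open SimpleGraph SemidirectProduct Literature.Barriers.CriticalPhenomena
open scoped Classical

/-! ### §1 Balls of `Cay(ℤ ≀_X 𝔊; a, b, c, d, s)` -/

/-- Every letter lies in the ball of radius `1`. [folklore] -/
theorem toW_mem_graphBall (y : L6) : y.toW ∈ graphBall Cay 1 1 :=
  ⟨Walk.cons (cay_adj_iff.2 ⟨y, (one_mul _).symm⟩) Walk.nil, le_rfl⟩

/-- `a t a ∈ B(1, 3)` for a letter `t`. [folklore] -/
theorem conj_aW_mem_graphBall (y : L6) : aW * y.toW * aW ∈ graphBall Cay 1 3 :=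
  Milnor.mul_mem_graphBall stdGens (Milnor.mul_mem_graphBall stdGens (toW_mem_graphBall .a) (toW_mem_graphBall y)) (toW_mem_graphBall .a)

/-- Seen from the base point `a`: if `g ∈ B(1, n)` then `g·a ∈ B(a, n + 2)` (the walk `a — 1 — ⋯ — g — g a`). [folklore] -/
theorem mul_aW_mem_graphBall {g : ↥wreathZ} {n : ℕ} (hg : g ∈ graphBall Cay 1 n) : g * aW ∈ graphBall Cay aW (n + 2) := by
  obtain ⟨w, hw⟩ := hg
  have h1 : Cay.Adj aW 1 := by
    have h := cay_adj_mul aW .a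
    rwa [show L6.a.toW = aW from rfl, tree_letters_sq.1] at h
  exact ⟨Walk.cons h1 (w.concat (cay_adj_mul g .a)), by rw [Walk.length_cons, Walk.length_concat]; omega⟩

/-! ### §2 The kernel of the block character is generated by kernel elements of bounded displacement -/

/-- The block character vanishes on lamp-free elements. [folklore] -/
theorem toAdd_blockChar_eq_zero_of_left {a : ↥stabOneW} (h : (((a : ↥wreathZ)) : LampGroup ℤ).left = 1) : Multiplicative.toAdd (blockChar a) = 0 := by
  rw [toAdd_blockChar, h, toAdd_one, map_zero]

/-- **The six words `b, c, d, aba, aca, ada` are lamp-free elements of `(⊕ ℤ) ⋊ St(1)` of word length `≤ 3`.** [cite: BartholdiErschler2012, §3.1 (St(1))] -/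
theorem exists_tree_witness : ∀ t ∈ stabOneGens, ∃ y : ↥stabOneW, (((y : ↥wreathZ)) : LampGroup ℤ) = inr t ∧ (y : ↥wreathZ) ∈ graphBall Cay 1 3 := by
  intro t ht
  have h3 : ∀ y : L6, y.toW ∈ graphBall Cay 1 3 := fun y => graphBall_mono _ _ (by norm_num) (toW_mem_graphBall y)
  have hconj : ∀ {g : Equiv.Perm Ray} (y : L6), (((y.toW : ↥wreathZ)) : LampGroup ℤ) = inr g → g ∈ stabOne →
      ∃ z : ↥stabOneW, (((z : ↥wreathZ)) : LampGroup ℤ) = inr (genA * g * genA) ∧ (z : ↥wreathZ) ∈ graphBall Cay 1 3 := by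
    intro g y hy hg
    have e : (((aW * y.toW * aW : ↥wreathZ)) : LampGroup ℤ) = inr (genA * g * genA) := by
      change (tree genA : LampGroup ℤ) * ((y.toW : ↥wreathZ) : LampGroup ℤ) * tree genA = _
      rw [hy, tree, ← map_mul, ← map_mul]
    refine ⟨⟨aW * y.toW * aW, mem_stabOneW.2 fun x => ?_⟩, e, conj_aW_mem_graphBall y⟩
    rw [e, right_inr]
    exact conj_genA_mem_stabOne hg x
  simp only [stabOneGens, Set.mem_insert_iff, Set.mem_singleton_iff] at ht
  rcases ht with rfl | rfl | rfl | rfl | rfl | rfl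
  · exact ⟨⟨bW, mem_stabOneW.2 fun x => genB_mem_stabOne x⟩, rfl, h3 .b⟩
  · exact ⟨⟨cW, mem_stabOneW.2 fun x => genC_mem_stabOne x⟩, rfl, h3 .c⟩
  · exact ⟨⟨dW, mem_stabOneW.2 fun x => genD_mem_stabOne x⟩, rfl, h3 .d⟩
  · exact hconj .b rfl genB_mem_stabOne
  · exact hconj .c rfl genC_mem_stabOne
  · exact hconj .d rfl genD_mem_stabOne

/-- The generating set of §2: kernel elements of word length `≤ 9`. [folklore] -/
theorem conj_mem_closure {K : Subgroup ↥stabOneW}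
    (hK : {g : ↥stabOneW | Multiplicative.toAdd (blockChar g) = 0 ∧ (g : ↥wreathZ) ∈ graphBall Cay 1 9} ⊆ (K : Set ↥stabOneW))
    (u y : ↥stabOneW) (hu : (u : ↥wreathZ) ∈ graphBall Cay 1 3) (hy : (y : ↥wreathZ) ∈ graphBall Cay 1 3)
    (hψ : Multiplicative.toAdd (blockChar y) = 0) : u * y * u⁻¹ ∈ K := by
  refine hK ⟨?_, ?_⟩
  · simp only [map_mul, map_inv, toAdd_mul, toAdd_inv, hψ, add_zero, add_neg_cancel]
  · exact Milnor.mul_mem_graphBall stdGens (Milnor.mul_mem_graphBall stdGens hu hy) (Milnor.inv_mem_graphBall stdGens hu)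

/-- **Conjugates of `St_𝔊(1)` by a short element lie in `K`**: if `K` contains the short kernel elements and `u ∈ (⊕ ℤ) ⋊ St(1)` has word length `≤ 3`, then for every
`x ∈ St_𝔊(1) = ⟨b, c, d, aba, aca, ada⟩` some element of `K` has underlying value `u x u⁻¹` (closure induction). [cite: BartholdiErschler2012, §3.1 (generators of St(1))] -/
theorem exists_conj_of_mem_closure {K : Subgroup ↥stabOneW}
    (hK : {g : ↥stabOneW | Multiplicative.toAdd (blockChar g) = 0 ∧ (g : ↥wreathZ) ∈ graphBall Cay 1 9} ⊆ (K : Set ↥stabOneW))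
    (u : ↥stabOneW) (hu : (u : ↥wreathZ) ∈ graphBall Cay 1 3) :
    ∀ x ∈ Subgroup.closure stabOneGens, ∃ y ∈ K,
      (((y : ↥wreathZ)) : LampGroup ℤ) = ((u : ↥wreathZ) : LampGroup ℤ) * inr x * (((u : ↥wreathZ) : LampGroup ℤ))⁻¹ := by
  intro x hx
  induction hx using Subgroup.closure_induction with
  | mem t ht =>
    obtain ⟨y, hy, hy3⟩ := exists_tree_witness t ht
    refine ⟨u * y * u⁻¹, conj_mem_closure hK u y hu hy3 (toAdd_blockChar_eq_zero_of_left (by rw [hy, left_inr])), ?_⟩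
    rw [← hy]; rfl
  | one => exact ⟨1, K.one_mem, by rw [map_one, mul_one, mul_inv_cancel]; rfl⟩
  | mul x z _ _ ihx ihz =>
    obtain ⟨a, ha, ea⟩ := ihx
    obtain ⟨b, hb, eb⟩ := ihz
    refine ⟨a * b, K.mul_mem ha hb, ?_⟩
    rw [show ((((a * b : ↥stabOneW)) : ↥wreathZ) : LampGroup ℤ) = (((a : ↥wreathZ)) : LampGroup ℤ) * (((b : ↥wreathZ)) : LampGroup ℤ) from rfl, ea, eb, map_mul]
    group
  | inv x _ ih =>
    obtain ⟨a, ha, ea⟩ := ih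
    refine ⟨a⁻¹, K.inv_mem ha, ?_⟩
    rw [show ((((a⁻¹ : ↥stabOneW)) : ↥wreathZ) : LampGroup ℤ) = ((((a : ↥wreathZ)) : LampGroup ℤ))⁻¹ from rfl, ea, map_inv]
    group

/-- **The lamp support of every element of `Γ₂` lies in the orbit `X = 𝔊ρ`.** [cite: BartholdiErschler2012, §2 (W = Σ_X A ⋊ G, X = ρG)] -/
theorem exists_apply_rho_of_mem_support {γ : LampGroup ℤ} (hγ : γ ∈ wreathZ) :
    ∀ x ∈ (Multiplicative.toAdd γ.left).support, ∃ g ∈ grigorchukGroup, g rho = x := by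
  induction hγ using Subgroup.closure_induction with
  | mem z hz =>
    simp only [Set.mem_insert_iff, Set.mem_singleton_iff] at hz
    intro x hx
    rcases hz with rfl | rfl | rfl | rfl | rfl
    · rw [tree_left, toAdd_one, Finsupp.support_zero] at hx; exact absurd hx (Finset.notMem_empty x)
    · rw [tree_left, toAdd_one, Finsupp.support_zero] at hx; exact absurd hx (Finset.notMem_empty x)
    · rw [tree_left, toAdd_one, Finsupp.support_zero] at hx; exact absurd hx (Finset.notMem_empty x)
    · rw [tree_left, toAdd_one, Finsupp.support_zero] at hx; exact absurd hx (Finset.notMem_empty x)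
    · rw [lamp_left, toAdd_ofAdd] at hx
      have hx' := Finsupp.support_single_subset hx
      rw [Finset.mem_singleton] at hx'
      exact ⟨1, grigorchukGroup.one_mem, by rw [hx', Equiv.Perm.one_apply]⟩
  | one => intro x hx; rw [one_left, toAdd_one, Finsupp.support_zero] at hx; exact absurd hx (Finset.notMem_empty x)
  | mul y z hy _ ihy ihz =>
    intro x hx
    rw [mul_left, toAdd_mul] at hx
    rcases Finset.mem_union.1 (Finsupp.support_add hx) with h | h
    · exact ihy x h
    · rw [toAdd_lampAut_apply, Finsupp.mem_support_iff, Finsupp.equivMapDomain_apply, ← Finsupp.mem_support_iff] at h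
      obtain ⟨g, hg, hgx⟩ := ihz _ h
      refine ⟨y.right * g, grigorchukGroup.mul_mem (right_mem_grigorchukGroup hy) hg, ?_⟩
      rw [Equiv.Perm.mul_apply, hgx]
      exact Equiv.apply_symm_apply _ _
  | inv y hy ih =>
    intro x hx
    rw [inv_left, toAdd_lampAut_apply, Finsupp.mem_support_iff, Finsupp.equivMapDomain_apply, toAdd_inv, Finsupp.neg_apply, neg_ne_zero,
      ← Finsupp.mem_support_iff] at hx
    obtain ⟨g, hg, hgx⟩ := ih _ hx
    refine ⟨y.right⁻¹ * g, grigorchukGroup.mul_mem (grigorchukGroup.inv_mem (right_mem_grigorchukGroup hy)) hg, ?_⟩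
    rw [Equiv.Perm.mul_apply, hgx]
    exact Equiv.apply_symm_apply _ _

/-- `h · (x ↦ 1)·h·(x ↦ 1)⁻¹)⁻¹ = (h x ↦ 1) − (x ↦ 1)` in the lamp group. [cite: BartholdiErschler2012, §2 (conjugates of lamp letters)] -/
theorem inr_mul_conj_inv (k : Equiv.Perm Ray) (x : Ray) :
    (inr k : LampGroup ℤ) * (lamp x 1 * inr k * (lamp x 1)⁻¹)⁻¹ = inl (Multiplicative.ofAdd (Finsupp.single (k x) 1 - Finsupp.single x 1)) := by
  rw [show (inr k : LampGroup ℤ) * (lamp x 1 * inr k * (lamp x 1)⁻¹)⁻¹ = tree k * lamp x 1 * (tree k)⁻¹ * (lamp x 1)⁻¹ by rw [tree]; group,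
    tree_mul_lamp_mul_tree_inv, lamp_inv, lamp, lamp, ← map_mul, ← ofAdd_add, Finsupp.single_neg, sub_eq_add_neg]

/-- The lamp letters `s^{±1}` as codes: value `(ρ ↦ m)`, `m = ±1`. [folklore] -/
theorem exists_lampCode {m : ℤ} (hm : m = 1 ∨ m = -1) : ∃ ℓ : L6, (((ℓ.toW : ↥wreathZ)) : LampGroup ℤ) = lamp rho m := by
  rcases hm with rfl | rfl
  · exact ⟨.s, rfl⟩
  · exact ⟨.si, by change (lamp rho (1 : ℤ) : LampGroup ℤ)⁻¹ = _; rw [lamp_inv]⟩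

/-- `a (ρ ↦ m) a = (aρ ↦ m)`. [cite: BartholdiErschler2012, §2 (conjugates of lamp letters)] -/
theorem coe_conj_aW_of_eq_lamp {x : ↥wreathZ} {m : ℤ} (hx : ((x : LampGroup ℤ)) = lamp rho m) : (((aW * x * aW : ↥wreathZ)) : LampGroup ℤ) = lamp (genA rho) m := by
  have e := tree_mul_lamp_mul_tree_inv (M := ℤ) genA rho m
  rw [show ((tree genA : LampGroup ℤ))⁻¹ = tree genA by rw [tree, ← map_inv, genA_inv]] at e
  change (tree genA : LampGroup ℤ) * (x : LampGroup ℤ) * tree genA = _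
  rw [hx, e]

/-- **The difference `δ_x − δ_{base(x)}` lies in `K`** for every orbit point `x = gρ` (`base(x) = ρ` if `x` begins with `1`, `aρ` if it begins with `0`): `g` or `g a`
lies in `St_𝔊(1)` (p590401 `mem_closure_stabOneGens_or`), and `δ_{hρ} − δ_ρ = h·(s h s⁻¹)⁻¹`, `δ_{h aρ} − δ_{aρ} = h·(s′ h s′⁻¹)⁻¹`.
[cite: BartholdiErschler2012, §3.1 ([𝔊 : St(1)] = 2, ρ = 1^∞)] -/
theorem exists_diff_single {K : Subgroup ↥stabOneW}
    (hK : {g : ↥stabOneW | Multiplicative.toAdd (blockChar g) = 0 ∧ (g : ↥wreathZ) ∈ graphBall Cay 1 9} ⊆ (K : Set ↥stabOneW))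
    {x : Ray} (hx : ∃ g ∈ grigorchukGroup, g rho = x) :
    ∃ y ∈ K, (((y : ↥wreathZ)) : LampGroup ℤ) =
      inl (Multiplicative.ofAdd (Finsupp.single x 1 - Finsupp.single (if x 0 then rho else genA rho) 1)) := by
  obtain ⟨g, hg, rfl⟩ := hx
  have h1 : (((1 : ↥stabOneW) : ↥wreathZ)) ∈ graphBall Cay 1 3 := mem_graphBall_self _ _ _
  have hsS : sW ∈ stabOneW := lamp_mem_stabOneW rfl
  have hs'S : s'W ∈ stabOneW := lamp_mem_stabOneW rfl
  have hs3 : sW ∈ graphBall Cay 1 3 := graphBall_mono _ _ (by norm_num) (toW_mem_graphBall .s)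
  have hs'3 : s'W ∈ graphBall Cay 1 3 := by
    rw [show s'W = aW * L6.s.toW * aW from Subtype.ext (coe_conj_aW_of_eq_lamp (x := L6.s.toW) (m := 1) rfl).symm]
    exact conj_aW_mem_graphBall .s
  have hSt : Subgroup.closure stabOneGens ≤ stabOne := (Subgroup.closure_le _).2 stabOneGens_subset_stabOne
  rcases mem_closure_stabOneGens_or hg with h | h
  · -- `g ∈ St(1)`: `gρ` begins with `1`
    have h0 : (g rho) 0 = true := by rw [mem_stabOne.1 (hSt h) rho]; rfl
    obtain ⟨T, hT, eT⟩ := exists_conj_of_mem_closure hK 1 h1 g h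
    obtain ⟨S, hS, eS⟩ := exists_conj_of_mem_closure hK ⟨sW, hsS⟩ hs3 g h
    refine ⟨T * S⁻¹, K.mul_mem hT (K.inv_mem hS), ?_⟩
    rw [h0, if_pos rfl, show ((((T * S⁻¹ : ↥stabOneW)) : ↥wreathZ) : LampGroup ℤ) = (((T : ↥wreathZ)) : LampGroup ℤ) * ((((S : ↥wreathZ)) : LampGroup ℤ))⁻¹
      from rfl, eT, eS, show ((((1 : ↥stabOneW)) : ↥wreathZ) : LampGroup ℤ) = 1 from rfl, one_mul, inv_one, mul_one]
    exact inr_mul_conj_inv g rho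
  · -- `g a ∈ St(1)`: `gρ = (ga)(aρ)` begins with `0`
    have eg : g rho = (g * genA) (genA rho) := by rw [Equiv.Perm.mul_apply, genA_genA_rho]
    have h0 : (g rho) 0 = false := by rw [eg, mem_stabOne.1 (hSt h) (genA rho), genA_rho_zero]
    obtain ⟨T, hT, eT⟩ := exists_conj_of_mem_closure hK 1 h1 _ h
    obtain ⟨S, hS, eS⟩ := exists_conj_of_mem_closure hK ⟨s'W, hs'S⟩ hs'3 _ h
    refine ⟨T * S⁻¹, K.mul_mem hT (K.inv_mem hS), ?_⟩
    rw [h0, show ((((T * S⁻¹ : ↥stabOneW)) : ↥wreathZ) : LampGroup ℤ) = (((T : ↥wreathZ)) : LampGroup ℤ) * ((((S : ↥wreathZ)) : LampGroup ℤ))⁻¹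
      from rfl, eT, eS, show ((((1 : ↥stabOneW)) : ↥wreathZ) : LampGroup ℤ) = 1 from rfl, one_mul, inv_one, mul_one, eg]
    exact inr_mul_conj_inv (g * genA) (genA rho)

/-- **Lamp normal form modulo `K`**: every configuration `f` supported in `X` differs from its collapsed form `(Σ_{1T} f)·δ_ρ + (Σ_{0T} f)·δ_{aρ}` by (the value of) an
element of `K` (induction on the support). [cite: BartholdiErschler2012, §2 (W = Σ_X A ⋊ G)] -/
theorem exists_lamp_normalForm {K : Subgroup ↥stabOneW}
    (hK : {g : ↥stabOneW | Multiplicative.toAdd (blockChar g) = 0 ∧ (g : ↥wreathZ) ∈ graphBall Cay 1 9} ⊆ (K : Set ↥stabOneW)) (f : Ray →₀ ℤ)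
    (hf : ∀ x ∈ f.support, ∃ g ∈ grigorchukGroup, g rho = x) :
    ∃ y ∈ K, (((y : ↥wreathZ)) : LampGroup ℤ) =
      inl (Multiplicative.ofAdd (f - Finsupp.single rho (blockSum f 1) - Finsupp.single (genA rho) (blockSum f 0))) := by
  induction f using Finsupp.induction with
  | zero => exact ⟨1, K.one_mem, by rw [map_zero, Pi.zero_apply, Pi.zero_apply, Finsupp.single_zero, Finsupp.single_zero, sub_zero, sub_zero]; rfl⟩
  | single_add a b f ha hb ih =>
    have hfa : f a = 0 := Finsupp.notMem_support_iff.1 ha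
    have haX : ∃ g ∈ grigorchukGroup, g rho = a :=
      hf a (Finsupp.mem_support_iff.2 (by rw [Finsupp.add_apply, Finsupp.single_eq_same, hfa, add_zero]; exact hb))
    have hfX : ∀ x ∈ f.support, ∃ g ∈ grigorchukGroup, g rho = x := fun x hx => hf x (Finsupp.mem_support_iff.2 (by
      have hxa : x ≠ a := fun e => ha (e ▸ hx)
      rw [Finsupp.add_apply, Finsupp.single_eq_of_ne hxa, zero_add]; exact Finsupp.mem_support_iff.1 hx))
    obtain ⟨yf, hyf, eyf⟩ := ih hfX
    obtain ⟨ya, hya, eya⟩ := exists_diff_single hK haX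
    refine ⟨ya ^ b * yf, K.mul_mem (K.zpow_mem hya b) hyf, ?_⟩
    rw [AddMonoidHom.map_add, Pi.add_apply, Pi.add_apply, blockSum_single,
      show ((((ya ^ b * yf : ↥stabOneW)) : ↥wreathZ) : LampGroup ℤ) = (((ya : ↥wreathZ)) : LampGroup ℤ) ^ b * (((yf : ↥wreathZ)) : LampGroup ℤ) from rfl,
      eya, eyf, ← map_zpow, ← map_mul, ← ofAdd_zsmul, ← ofAdd_add]
    congr 2
    cases h0 : a 0
    · simp only [Bool.false_eq_true, if_false, Pi.single_eq_same, Pi.single_eq_of_ne (one_ne_zero : (1 : Fin 2) ≠ 0), zero_add, smul_sub,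
        Finsupp.smul_single_one, Finsupp.single_add]
      abel
    · simp only [if_true, Pi.single_eq_same, Pi.single_eq_of_ne (zero_ne_one : (0 : Fin 2) ≠ 1), zero_add, smul_sub, Finsupp.smul_single_one,
        Finsupp.single_add]
      abel

/-- **THE KERNEL OF THE BLOCK CHARACTER IS GENERATED BY KERNEL ELEMENTS OF WORD LENGTH `≤ 9`** (`ker ψ = L₀ ⋊ St_𝔊(1)`, §2 of the module doc).
[cite: BartholdiErschler2012, §2, §3.1] -/
theorem ker_blockChar_le_closure (k : ↥stabOneW) (hk : Multiplicative.toAdd (blockChar k) = 0) :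
    k ∈ Subgroup.closure {g : ↥stabOneW | Multiplicative.toAdd (blockChar g) = 0 ∧ (g : ↥wreathZ) ∈ graphBall Cay 1 9} := by
  set K := Subgroup.closure {g : ↥stabOneW | Multiplicative.toAdd (blockChar g) = 0 ∧ (g : ↥wreathZ) ∈ graphBall Cay 1 9}
  have hK : {g : ↥stabOneW | Multiplicative.toAdd (blockChar g) = 0 ∧ (g : ↥wreathZ) ∈ graphBall Cay 1 9} ⊆ (K : Set ↥stabOneW) := Subgroup.subset_closure
  have hkw : (((k : ↥wreathZ)) : LampGroup ℤ) ∈ wreathZ := (k : ↥wreathZ).2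
  -- the tree part lies in `St_𝔊(1) = ⟨b, c, d, aba, aca, ada⟩`
  have hright : (((k : ↥wreathZ)) : LampGroup ℤ).right ∈ Subgroup.closure stabOneGens := by
    rw [← stabOne_inf_grigorchukGroup]
    exact Subgroup.mem_inf.2 ⟨mem_stabOne.2 (mem_stabOneW.1 k.2), right_mem_grigorchukGroup hkw⟩
  obtain ⟨T, hT, eT⟩ := exists_conj_of_mem_closure hK 1 (mem_graphBall_self _ _ _) _ hright
  -- the lamp part has both block sums zero, hence is (the value of) an element of `K`
  obtain ⟨Y, hY, eY⟩ := exists_lamp_normalForm hK (Multiplicative.toAdd (((k : ↥wreathZ)) : LampGroup ℤ).left) (exists_apply_rho_of_mem_support hkw)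
  rw [← toAdd_blockChar, hk, Pi.zero_apply, Pi.zero_apply, Finsupp.single_zero, Finsupp.single_zero, sub_zero, sub_zero, ofAdd_toAdd] at eY
  rw [show ((((1 : ↥stabOneW)) : ↥wreathZ) : LampGroup ℤ) = 1 from rfl, one_mul, inv_one, mul_one] at eT
  have e : Y * T = k := Subtype.ext (Subtype.ext (by
    rw [show ((((Y * T : ↥stabOneW)) : ↥wreathZ) : LampGroup ℤ) = (((Y : ↥wreathZ)) : LampGroup ℤ) * (((T : ↥wreathZ)) : LampGroup ℤ) from rfl, eY, eT,
      inl_left_mul_inr_right]))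
  rw [← e]
  exact K.mul_mem hY hT

end Grigorchuk

end Summit.CriticalPhenomena.PercolationContinuityZ3.Theorems.Transplant

end
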